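import Mathlib
import HarnessLib
import Summits.Ventures.LatticeQCDFlow.Scaling.AutoregressiveGaugeProposalAveraging
import Summits.Ventures.LatticeQCDFlow.Scaling.TorusPlaquetteGeometry

/-!
# LatticeQCDFlow / Scaling — A PROPOSAL FOR THE CLOSING LINK THAT IGNORES ANY ONE STAPLE LINK IS NO
# BETTER THAN HAAR (every compact gauge group, every dimension)

HONEST FRAMING: exact (Metropolis-corrected) sampling algorithms for lattice gauge theory;
figures of merit are autocorrelation/cost numbers at stated couplings and volumes; no
continuum-physics claim.

Venture `LatticeQCDFlow` (cell pub-lqcd), topic `Scaling`, FANOUT row 30 (lean-1, GEN-18) — OUR WORK for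
THEORY-2 §4 row C5 (gauge case): the plaquette assembly of `Scaling/AutoregressiveGaugeProposalAveraging`.
Any `d`, `L ≥ 2`, compact group `G` (Haar probability `μ`, `π = μ^{⊗E}`), bounded measurable gauge-invariant
weight `F`; a square `(x; k, l)`, `k ≠ l`, with closing link `e₁ = (x, k)` and staple links `e₂ = (x+e_k, l)`,
`e₃ = (x+e_l, k)`, `e₄ = (x, l)`; integrated links `s` containing every link at the three corners `x`,
`x+e_k`, `x+e_l` other than `e₁, …, e₄`; `N = A_s F`, `M = A_{insert e₁ s} F` (so `N/M` is the exact
autoregressive conditional density of `U_{e₁}`); a bounded measurable "proposal density" `q`, normalised in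
the coordinate `e₁` (`∫ q(U[e₁ ↦ v]) dv = 1`).

* §1 one-coordinate Haar averages of a proposal: measurable, bounded, blind, and normalisation is inherited
  (`haarAvg_update_*`).
* §2 **`integral_abs_sub_le_of_blind_stapleLink`** — if `q` is BLIND to any one of `e₂, e₃, e₄` then
  `∫ |N − M| dπ ≤ ∫ |N − q·M| dπ`: the Wilson-weighted `L¹` error of `q` (twice the `π`-average total
  variation to the exact conditional) is at least that of the Haar proposal `q ≡ 1`.  `e₂`: through-corner
  at `x+e_k`; `e₄`: out-corner at `x`; `e₃`: through-corner at `x+e_l` (averaging over `e₄`), then the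
  out-corner at `x`.  **`integral_abs_sub_le_of_blind_stapleLink_marginal`** — the plaquette marginal
  (`s` = all links off the square); **`wilson_integral_abs_sub_le_of_blind_stapleLink`** — the Wilson weight.

READING (value-free): for the exact conditional of a gauge link closing a plaquette whose other corner links
are integrated, partial context is worthless — a learned proposal must read ALL THREE staple links to beat
the context-free Haar proposal in average total variation; with `Scaling/AutoregressiveGaugePlaquetteMarginal`
the Haar error is `≥ ⟨Re tr ρ(U_p) e^{−βS}⟩/N`, volume-uniformly.  NOT CLAIMED: anything about proposals
reading all three; any number of ours.  Elementary over the parents; no `def`; nothing cited as a fact; no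
`sorry`.
-/

noncomputable section

namespace Summit.Ventures.LatticeQCDFlow.Theory2.Autoregressive

open MeasureTheory Function Set
open Literature.MathematicalPhysics.QuantumFieldTheory
open Summit.Ventures.LatticeQCDFlow.Exactness
open Summit.Ventures.LatticeQCDFlow.Theory2.Lattice.TorusGeom (single_inj add_single_ne_self)

variable {d L : ℕ} {G : Type*} [Group G] [TopologicalSpace G] [IsTopologicalGroup G] [CompactSpace G]
  [SecondCountableTopology G] [MeasurableSpace G] [BorelSpace G] [NeZero L]

/-! ## §1 One-coordinate Haar averages of a proposal -/

omit [Group G] [TopologicalSpace G] [IsTopologicalGroup G] [CompactSpace G] [SecondCountableTopology G]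
  [BorelSpace G] [NeZero L] in
/-- Joint measurability of a double coordinate update `(v, w) ↦ U[e ↦ v][ℓ ↦ w]`. [ours] -/
theorem measurable_edgeUpdate_two (U : GaugeConfig d L G) (e ℓ : Edge d L) :
    Measurable fun p : G × G => update (update U e p.1) ℓ p.2 := by
  classical
  refine measurable_pi_lambda _ fun e' => ?_
  by_cases h1 : e' = ℓ
  · subst h1; simp only [update_self]; exact measurable_snd
  · by_cases h2 : e' = e
    · subst h2; simp only [update_of_ne h1, update_self]; exact measurable_fst
    · simp only [update_of_ne h1, update_of_ne h2]; exact measurable_const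

omit [SecondCountableTopology G] [NeZero L] in
/-- The Haar average of a measurable `q` over one coordinate is measurable. [ours] -/
theorem measurable_haarAvg_update (ℓ : Edge d L) {q : GaugeConfig d L G → ℝ} (hqm : Measurable q) :
    Measurable fun U : GaugeConfig d L G => ∫ v, q (update U ℓ v) ∂(haarProbability G) := by
  classical
  have hm : Measurable fun p : GaugeConfig d L G × G => q (update p.1 ℓ p.2) :=
    hqm.comp (measurable_pi_lambda _ fun e => by
      by_cases he : e = ℓ
      · subst he; simp only [update_self]; exact measurable_snd
      · simp only [update_of_ne he]; exact (measurable_pi_apply e).comp measurable_fst)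
  exact (hm.stronglyMeasurable.integral_prod_right' (ν := haarProbability G)).measurable

omit [SecondCountableTopology G] [NeZero L] in
/-- The Haar average of a bounded `q` over one coordinate obeys the same bound. [ours] -/
theorem abs_haarAvg_update_le (ℓ : Edge d L)
    {q : GaugeConfig d L G → ℝ} {C : ℝ} (hqb : ∀ U, |q U| ≤ C) (U : GaugeConfig d L G) :
    |∫ v, q (update U ℓ v) ∂(haarProbability G)| ≤ C := by
  have h := norm_integral_le_of_norm_le_const (μ := haarProbability G) (f := fun v => q (update U ℓ v))
    (C := C) (ae_of_all _ fun v => by rw [Real.norm_eq_abs]; exact hqb _)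
  rw [Real.norm_eq_abs] at h
  simpa [Measure.real, measure_univ] using h

omit [Group G] [TopologicalSpace G] [IsTopologicalGroup G] [CompactSpace G] [SecondCountableTopology G]
  [BorelSpace G] [NeZero L] in
/-- The average of `q` over the coordinate `ℓ` is blind to `ℓ`. [ours] -/
theorem haarAvg_update_blind (ν : Measure G) (ℓ : Edge d L)
    (q : GaugeConfig d L G → ℝ) (U : GaugeConfig d L G) (w : G) :
    ∫ v, q (update (update U ℓ w) ℓ v) ∂ν = ∫ v, q (update U ℓ v) ∂ν := by
  simp only [update_idem]

omit [SecondCountableTopology G] [NeZero L] in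
/-- **Normalisation is inherited**: if `q` is a probability density in the coordinate `e` (for every
configuration) then so is its Haar average over another coordinate `ℓ ≠ e` (Fubini). [ours] -/
theorem haarAvg_update_normalised {e ℓ : Edge d L} (heℓ : e ≠ ℓ) {q : GaugeConfig d L G → ℝ}
    (hqm : Measurable q) (hqb : ∃ C, ∀ U, |q U| ≤ C)
    (hq₁ : ∀ U, ∫ v, q (update U e v) ∂(haarProbability G) = 1) (U : GaugeConfig d L G) :
    ∫ v, (∫ w, q (update (update U e v) ℓ w) ∂(haarProbability G)) ∂(haarProbability G) = 1 := by
  set μ := haarProbability G with hμ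
  obtain ⟨C, hC⟩ := hqb
  have hm : Measurable fun p : G × G => q (update (update U e p.1) ℓ p.2) :=
    hqm.comp (measurable_edgeUpdate_two U e ℓ)
  have hi : Integrable (uncurry fun v w => q (update (update U e v) ℓ w)) (μ.prod μ) :=
    Integrable.mono' (integrable_const C) hm.aestronglyMeasurable
      (ae_of_all _ fun p => by rw [Real.norm_eq_abs]; exact hC _)
  rw [integral_integral_swap hi]
  have hinner : ∀ w : G, ∫ v, q (update (update U e v) ℓ w) ∂μ = 1 := by
    intro w
    have : ∀ v, update (update U e v) ℓ w = update (update U ℓ w) e v := fun v => update_comm heℓ _ _ _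
    simp_rw [this]
    exact hq₁ _
  simp_rw [hinner]
  simp [hμ]

/-! ## §2 The plaquette: blind to one staple link ⇒ no better than Haar -/

/-- **A PROPOSAL FOR THE CLOSING LINK BLIND TO ANY ONE STAPLE LINK IS NO BETTER THAN HAAR.**  Square
`(x; k, l)`, `k ≠ l`, `L ≥ 2`; `e₁ = (x, k)`, `e₂ = (x+e_k, l)`, `e₃ = (x+e_l, k)`, `e₄ = (x, l)`; `s` contains
every link at the corners `x`, `x+e_k`, `x+e_l` except `e₁, …, e₄`; `F` bounded measurable gauge-invariant;
`N = A_s F`, `M = A_{insert e₁ s} F`; `q` bounded measurable with `∫ q(U[e₁ ↦ v]) dv = 1`.  If `q` is blind to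
one of `e₂, e₃, e₄` then `∫ |N − M| dπ ≤ ∫ |N − q·M| dπ`. [ours] -/
theorem integral_abs_sub_le_of_blind_stapleLink (hL : 2 ≤ L) {F : GaugeConfig d L G → ℝ}
    (hF : IsGaugeInvariant F) (hFm : Measurable F) (hFb : ∃ C, ∀ U, |F U| ≤ C)
    (x : Site d L) {k l : Fin d} (hkl : k ≠ l) {s : Finset (Edge d L)}
    (hcor : ∀ e : Edge d L,
      (e.1 = x ∨ e.1.shift e.2 = x) ∨ (e.1 = x.shift k ∨ e.1.shift e.2 = x.shift k) ∨
        (e.1 = x.shift l ∨ e.1.shift e.2 = x.shift l) →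
      e ≠ (x, k) → e ≠ (x.shift k, l) → e ≠ (x.shift l, k) → e ≠ (x, l) → e ∈ s)
    {q : GaugeConfig d L G → ℝ} (hqm : Measurable q) (hqb : ∃ C, ∀ U, |q U| ≤ C)
    (hq₁ : ∀ U, ∫ v, q (update U (x, k) v) ∂(haarProbability G) = 1)
    {b : Edge d L} (hb : b ∈ ({(x.shift k, l), (x.shift l, k), (x, l)} : Finset (Edge d L)))
    (hqb' : ∀ U v, q (update U b v) = q U) :
    ∫ U, |coordAvg (haarProbability G) s F U - coordAvg (haarProbability G) (insert (x, k) s) F U|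
        ∂Measure.pi (fun _ : Edge d L => haarProbability G) ≤
      ∫ U, |coordAvg (haarProbability G) s F U - q U * coordAvg (haarProbability G) (insert (x, k) s) F U|
        ∂Measure.pi (fun _ : Edge d L => haarProbability G) := by
  classical
  -- geometry (`L ≥ 2`, `k ≠ l`)
  haveI : Fact (1 < L) := ⟨hL⟩
  have hek : ∀ z : Site d L, z.shift k ≠ z := fun z => add_single_ne_self hL z k
  have hel : ∀ z : Site d L, z.shift l ≠ z := fun z => add_single_ne_self hL z l
  have hkl' : x.shift k ≠ x.shift l := fun h => hkl (single_inj hL (add_left_cancel h))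
  have hcomm : (x.shift k).shift l = (x.shift l).shift k := by
    simp only [Site.shift]; exact add_right_comm _ _ _
  have hekl : (x.shift k).shift l ≠ x := by
    intro h
    have h' := congrFun h k
    simp [Site.shift, Pi.single_eq_of_ne hkl] at h'
  have hinc : ∀ (e : Edge d L) (y : Site d L), e.1 ≠ y → e.1.shift e.2 ≠ y →
      ¬ (e.1 = y ∨ e.1.shift e.2 = y) := fun e y h1 h2 h => h.elim h1 h2
  have h14 : ((x, k) : Edge d L) ≠ (x, l) := fun h => hkl (congrArg Prod.snd h)
  have h12 : ((x, k) : Edge d L) ≠ (x.shift k, l) := fun h => (hek x).symm (congrArg Prod.fst h)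
  have h43 : ((x, l) : Edge d L) ≠ (x.shift l, k) := fun h => (hel x).symm (congrArg Prod.fst h)
  -- the three corner stars
  have hstar_x : ∀ e : Edge d L, e.1 = x ∨ e.1.shift e.2 = x → e ≠ (x, k) → e ≠ (x, l) → e ∈ s := by
    intro e he hn1 hn4
    refine hcor e (Or.inl he) hn1 (fun h => ?_) (fun h => ?_) hn4 <;> subst h
    · exact hinc _ _ (show x.shift k ≠ x from hek x) (show (x.shift k).shift l ≠ x from hekl) he
    · exact hinc _ _ (show x.shift l ≠ x from hel x)
        (show (x.shift l).shift k ≠ x by rw [← hcomm]; exact hekl) he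
  have hstar_k : ∀ e : Edge d L, e.1 = x.shift k ∨ e.1.shift e.2 = x.shift k → e ≠ (x, k) →
      e ≠ (x.shift k, l) → e ∈ s := by
    intro e he hn1 hn2
    refine hcor e (Or.inr (Or.inl he)) hn1 hn2 (fun h => ?_) (fun h => ?_) <;> subst h
    · exact hinc _ _ (show x.shift l ≠ x.shift k from hkl'.symm)
        (show (x.shift l).shift k ≠ x.shift k by rw [← hcomm]; exact hel (x.shift k)) he
    · exact hinc _ _ (show x ≠ x.shift k from (hek x).symm) (show x.shift l ≠ x.shift k from hkl'.symm) he
  have hstar_l : ∀ e : Edge d L, e.1 = x.shift l ∨ e.1.shift e.2 = x.shift l → e ≠ (x, l) →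
      e ≠ (x.shift l, k) → e ∈ s := by
    intro e he hn4 hn3
    refine hcor e (Or.inr (Or.inr he)) (fun h => ?_) (fun h => ?_) hn3 hn4 <;> subst h
    · exact hinc _ _ (show x ≠ x.shift l from (hel x).symm) (show x.shift k ≠ x.shift l from hkl') he
    · exact hinc _ _ (show x.shift k ≠ x.shift l from hkl')
        (show (x.shift k).shift l ≠ x.shift l by rw [hcomm]; exact hek (x.shift l)) he
  simp only [Finset.mem_insert, Finset.mem_singleton] at hb
  rcases hb with rfl | rfl | rfl
  · -- `b = e₂`: through the corner `x + e_k` (`e₁` arrives, `e₂` leaves)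
    have h := integral_abs_sub_avg_le_of_cornerThrough (G := G) s (x, k) hF hFm hFb (y := x.shift k)
      (ℓ₁ := (x, k)) (ℓ₂ := (x.shift k, l)) h12 rfl (hek x).symm rfl (hel (x.shift k)) hstar_k hqm hqb hqb'
    simpa only [hq₁, one_mul] using h
  · -- `b = e₃`: through the corner `x + e_l` (average over `e₄`), then out of the corner `x`
    have h1 := integral_abs_sub_avg_le_of_cornerThrough (G := G) s (x, k) hF hFm hFb (y := x.shift l)
      (ℓ₁ := (x, l)) (ℓ₂ := (x.shift l, k)) h43 rfl (hel x).symm rfl (hek (x.shift l)) hstar_l hqm hqb hqb'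
    obtain ⟨C, hC⟩ := hqb
    have h2 := integral_abs_sub_avg_le_of_cornerOut (G := G) s (x, k) hF hFm hFb (y := x)
      (ℓ₁ := (x, k)) (ℓ₂ := (x, l)) h14 rfl (hek x) rfl (hel x) hstar_x
      (q := fun U => ∫ v, q (update U (x, l) v) ∂(haarProbability G)) (measurable_haarAvg_update (x, l) hqm)
      ⟨C, abs_haarAvg_update_le (x, l) hC⟩ (fun U v => haarAvg_update_blind (haarProbability G) (x, l) q U v)
    have hn : ∀ U : GaugeConfig d L G,
        ∫ v, (∫ w, q (update (update U (x, k) v) (x, l) w) ∂(haarProbability G)) ∂(haarProbability G) = 1 :=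
      haarAvg_update_normalised h14 hqm ⟨C, hC⟩ hq₁
    simp only [hn, one_mul] at h2
    exact h2.trans h1
  · -- `b = e₄`: out of the corner `x` (`e₁`, `e₄` both leave)
    have h := integral_abs_sub_avg_le_of_cornerOut (G := G) s (x, k) hF hFm hFb (y := x)
      (ℓ₁ := (x, k)) (ℓ₂ := (x, l)) h14 rfl (hek x) rfl (hel x) hstar_x hqm hqb hqb'
    simpa only [hq₁, one_mul] using h

/-- **The plaquette marginal** (`s` = all links off the square `(x; k, l)`): a proposal for `U_{e₁}` given the
staple that is blind to any one staple link is no better than Haar, `∫ |N − M| dπ ≤ ∫ |N − q·M| dπ`. [ours] -/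
theorem integral_abs_sub_le_of_blind_stapleLink_marginal (hL : 2 ≤ L) {F : GaugeConfig d L G → ℝ}
    (hF : IsGaugeInvariant F) (hFm : Measurable F) (hFb : ∃ C, ∀ U, |F U| ≤ C)
    (x : Site d L) {k l : Fin d} (hkl : k ≠ l)
    {q : GaugeConfig d L G → ℝ} (hqm : Measurable q) (hqb : ∃ C, ∀ U, |q U| ≤ C)
    (hq₁ : ∀ U, ∫ v, q (update U (x, k) v) ∂(haarProbability G) = 1)
    {b : Edge d L} (hb : b ∈ ({(x.shift k, l), (x.shift l, k), (x, l)} : Finset (Edge d L)))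
    (hqb' : ∀ U v, q (update U b v) = q U) :
    ∫ U, |coordAvg (haarProbability G) (Finset.univ \ {(x, k), (x.shift k, l), (x.shift l, k), (x, l)}) F U -
          coordAvg (haarProbability G)
            (insert (x, k) (Finset.univ \ {(x, k), (x.shift k, l), (x.shift l, k), (x, l)})) F U|
        ∂Measure.pi (fun _ : Edge d L => haarProbability G) ≤
      ∫ U, |coordAvg (haarProbability G) (Finset.univ \ {(x, k), (x.shift k, l), (x.shift l, k), (x, l)}) F U -
          q U * coordAvg (haarProbability G)
            (insert (x, k) (Finset.univ \ {(x, k), (x.shift k, l), (x.shift l, k), (x, l)})) F U|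
        ∂Measure.pi (fun _ : Edge d L => haarProbability G) := by
  classical
  refine integral_abs_sub_le_of_blind_stapleLink hL hF hFm hFb x hkl (fun e _ h1 h2 h3 h4 => ?_) hqm hqb
    hq₁ hb hqb'
  simp [h1, h2, h3, h4]

/-! ## §3 The Wilson weight -/

variable {N : ℕ} (ρ : G →* Matrix (Fin N) (Fin N) ℂ)

/-- **Wilson action, every compact gauge group, every dimension** (continuous `ρ`, any `β`, `L ≥ 2`): with
`s` the links off the square `(x; k, l)`, `N = A_s e^{−βS_W}`, `M = A_{insert (x,k) s} e^{−βS_W}`, every bounded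
measurable proposal density `q` for `U_{(x,k)}` that is blind to one of the three staple links satisfies
`∫ |N − M| dπ ≤ ∫ |N − q·M| dπ` — it is no closer to the exact conditional than the Haar proposal. [ours] -/
theorem wilson_integral_abs_sub_le_of_blind_stapleLink (hρ : Continuous ρ) (hL : 2 ≤ L) (β : ℝ)
    (x : Site d L) {k l : Fin d} (hkl : k ≠ l)
    {q : GaugeConfig d L G → ℝ} (hqm : Measurable q) (hqb : ∃ C, ∀ U, |q U| ≤ C)
    (hq₁ : ∀ U, ∫ v, q (update U (x, k) v) ∂(haarProbability G) = 1)
    {b : Edge d L} (hb : b ∈ ({(x.shift k, l), (x.shift l, k), (x, l)} : Finset (Edge d L)))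
    (hqb' : ∀ U v, q (update U b v) = q U) :
    ∫ U, |coordAvg (haarProbability G) (Finset.univ \ {(x, k), (x.shift k, l), (x.shift l, k), (x, l)})
            (fun V : GaugeConfig d L G => Real.exp (-β * wilsonAction ρ V)) U -
          coordAvg (haarProbability G)
            (insert (x, k) (Finset.univ \ {(x, k), (x.shift k, l), (x.shift l, k), (x, l)}))
            (fun V : GaugeConfig d L G => Real.exp (-β * wilsonAction ρ V)) U|
        ∂Measure.pi (fun _ : Edge d L => haarProbability G) ≤
      ∫ U, |coordAvg (haarProbability G) (Finset.univ \ {(x, k), (x.shift k, l), (x.shift l, k), (x, l)})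
            (fun V : GaugeConfig d L G => Real.exp (-β * wilsonAction ρ V)) U -
          q U * coordAvg (haarProbability G)
            (insert (x, k) (Finset.univ \ {(x, k), (x.shift k, l), (x.shift l, k), (x, l)}))
            (fun V : GaugeConfig d L G => Real.exp (-β * wilsonAction ρ V)) U|
        ∂Measure.pi (fun _ : Edge d L => haarProbability G) := by
  obtain ⟨B, hB⟩ := exists_abs_wilsonAction_le (d := d) (L := L) ρ hρ
  have hb' : ∀ U : GaugeConfig d L G, |Real.exp (-β * wilsonAction ρ U)| ≤ Real.exp (|β| * B) := by
    intro U
    rw [abs_of_pos (Real.exp_pos _), Real.exp_le_exp]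
    have h : |-β * wilsonAction ρ U| ≤ |β| * B := by
      rw [abs_mul, abs_neg]; exact mul_le_mul_of_nonneg_left (hB U) (abs_nonneg _)
    exact (abs_le.1 h).2
  exact integral_abs_sub_le_of_blind_stapleLink_marginal hL (isGaugeInvariant_wilsonWeightFun ρ β)
    (Real.measurable_exp.comp ((measurable_wilsonAction ρ hρ).const_mul _)) ⟨_, hb'⟩ x hkl hqm hqb hq₁ hb
    hqb'

end Summit.Ventures.LatticeQCDFlow.Theory2.Autoregressive

end
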